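import Summits.ResolutionOfSingularities.ResolutionOfSingularities.Theorems.FrobeniusLadderFRationalResolutionFixedPointFibre
import Mathlib.RingTheory.Ideal.Cotangent
import Mathlib.Algebra.Module.SpanRankOperations
import Mathlib.RingTheory.RegularLocalRing.Defs
import Mathlib.LinearAlgebra.Dimension.Constructions
import Mathlib.RingTheory.Localization.AtPrime.Basic
import HarnessLib

/-!
# Crux `FrobeniusLadder.FRationalResolution` (stmt-ResolutionOfSingularities-15317), line `redirect`,
# stub `stub_diagonalizableQuotientResolution` — HOMOGENEOUS minimal generators of the maximal ideal
# at a `D(A)`-fixed point (entrance of the linearisation step L3)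

`…FixedPointFibre.lean` (p812294/p812323) shows that a prime `𝔔` of an `A`-graded ring `S` containing
every piece `S_a`, `a ≠ 0` (a FIXED point of the `D(A)`-action) is generated by `𝔔 ∩ S₀` and the
pieces of non-zero degree. The linearisation step of any proof of the stub (étale/formal-local model
`κ[[x₁,…,x_n]]` with DIAGONAL action, `Ŝ₀ = κ[[M]]`) starts from a regular system of parameters of
`S_𝔔` consisting of HOMOGENEOUS elements of `S`. This file supplies it, by graded Nakayama:

* `exists_finset_subset_span_eq_card_eq_spanFinrank` — **minimal generators can be extracted from ANY
  generating set**: in a Noetherian local ring, every set `G` with `span G = 𝔪` contains a finite subset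
  generating `𝔪` of cardinality `spanFinrank 𝔪 = dim_κ 𝔪/𝔪²` (a spanning set of the cotangent space
  contains a basis; Nakayama);
* `span_homogeneous_eq_of_fixed` — at a fixed prime, `𝔔` is the span of its HOMOGENEOUS elements;
* `exists_homogeneous_minimal_generators_of_fixed` — **at a fixed prime `𝔔` of a Noetherian graded
  `S` there are finitely many homogeneous `x₁,…,x_n ∈ 𝔔`, `n = spanFinrank (𝔔 S_𝔔)` (the embedding
  dimension), whose images generate the maximal ideal of `S_𝔔`**;
* `exists_homogeneous_regularParameters_of_fixed` — for `S` regular, the same with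
  `n = dim S_𝔔`: a regular system of parameters of `S_𝔔` made of homogeneous elements.

Honest label: an elementary brick of L3 (no stub closed; the formal/étale-local structure theorem it
feeds is not in the tree). No definitions, no named facts, no sorry.
[folklore; cite: SGA3, Exp. VIII §4–5] [cite: BrunsHerzog1998, Prop. 1.5.15 (graded Nakayama)]
-/

noncomputable section

-- single-problem summit: the doubled namespace component is forced
set_option linter.dupNamespace false

open DirectSum IsLocalRing

namespace Summit.ResolutionOfSingularities.ResolutionOfSingularities.Theorems.FRationalResolution.FixedPointGenerators

universe u v w

/-! ## Minimal generators inside a given generating set (Nakayama) -/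

/-- **Minimal generators of the maximal ideal can be chosen inside any generating set.** In a
Noetherian local ring `R`, if `G ⊆ R` generates `𝔪` then some finite `t ⊆ G` generates `𝔪` and has
exactly `spanFinrank 𝔪 = dim_κ (𝔪/𝔪²)` elements: the images of `G` span the cotangent space, a
spanning set of a vector space contains a basis, and lifts of a basis generate `𝔪` by Nakayama
(Mathlib `IsLocalRing.CotangentSpace.span_image_eq_top_iff`). [folklore; cite: BrunsHerzog1998, Prop. 1.5.15] -/
theorem exists_finset_subset_span_eq_card_eq_spanFinrank {R : Type u} [CommRing R] [IsLocalRing R]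
    [IsNoetherianRing R] (G : Set R) (hG : Ideal.span G = maximalIdeal R) :
    ∃ t : Finset R, (↑t : Set R) ⊆ G ∧ Ideal.span (↑t : Set R) = maximalIdeal R ∧
      t.card = (maximalIdeal R).spanFinrank := by
  classical
  set m := maximalIdeal R with hm
  have hGm : G ⊆ (m : Set R) := fun x hx => hG ▸ Ideal.subset_span hx
  -- the generating set, seen inside the module `m`
  let s : Set m := {x | (x : R) ∈ G}
  have hs_img : (m.subtype : m → R) '' s = G := by
    ext x
    constructor
    · rintro ⟨y, hy, rfl⟩
      exact hy
    · intro hx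
      exact ⟨⟨x, hGm hx⟩, hx, rfl⟩
  have hs_top : Submodule.span R s = ⊤ := by
    apply Submodule.map_injective_of_injective m.injective_subtype
    rw [Submodule.map_span, hs_img, Submodule.map_top, Submodule.range_subtype]
    exact hG
  -- the images span the cotangent space; extract a basis
  have hV : Submodule.span (ResidueField R) (m.toCotangent '' s) = ⊤ :=
    CotangentSpace.span_image_eq_top_iff.mpr hs_top
  obtain ⟨b, hb_sub, hb_span, hb_li⟩ :=
    exists_linearIndependent (ResidueField R) (m.toCotangent '' s)
  rw [hV] at hb_span
  have hb_fin : b.Finite := hb_li.set_finite_of_isNoetherian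
  haveI : Fintype b := hb_fin.fintype
  have hcard_b : Module.finrank (ResidueField R) (CotangentSpace R) = b.toFinset.card := by
    rw [← finrank_top, ← hb_span]
    exact finrank_span_set_eq_card (R := ResidueField R) hb_li
  -- lift the basis into `s`
  have hpre : ∀ v : b, ∃ x : m, (x : R) ∈ G ∧ m.toCotangent x = v := fun v => by
    obtain ⟨x, hx, hxv⟩ := hb_sub v.2
    exact ⟨x, hx, hxv⟩
  choose f hfG hfeq using hpre
  let t : Finset R := Finset.univ.image fun v : b => (f v : R)
  have ht_sub : (↑t : Set R) ⊆ G := by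
    intro x hx
    rw [Finset.coe_image, Finset.coe_univ, Set.image_univ] at hx
    obtain ⟨v, rfl⟩ := hx
    exact hfG v
  -- the lifts generate `m` (Nakayama)
  have hrange_top : Submodule.span R (Set.range f) = ⊤ := by
    refine CotangentSpace.span_image_eq_top_iff.mp ?_
    refine eq_top_iff.mpr (hb_span ▸ Submodule.span_le.mpr fun v hv => ?_)
    exact Submodule.subset_span ⟨f ⟨v, hv⟩, ⟨⟨v, hv⟩, rfl⟩, hfeq ⟨v, hv⟩⟩
  have ht_span : Ideal.span (↑t : Set R) = m := by
    have himg : (m.subtype : m → R) '' Set.range f = (↑t : Set R) := by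
      rw [Finset.coe_image, Finset.coe_univ, Set.image_univ, ← Set.range_comp]
      rfl
    have := congrArg (Submodule.map m.subtype) hrange_top
    rw [Submodule.map_span, himg, Submodule.map_top, Submodule.range_subtype] at this
    exact this
  refine ⟨t, ht_sub, ht_span, le_antisymm ?_ ?_⟩
  · -- `card t ≤ card b = finrank = spanFinrank`
    calc t.card ≤ (Finset.univ : Finset b).card := Finset.card_image_le
      _ = b.toFinset.card := by rw [Finset.card_univ, Set.toFinset_card]
      _ = m.spanFinrank := by
        rw [← hcard_b, hm, spanFinrank_maximalIdeal_eq_finrank_cotangentSpace]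
  · -- any generating set has at least `spanFinrank` elements
    have h := Submodule.spanFinrank_span_le_ncard_of_finite (R := R) (M := R) t.finite_toSet
    rw [Set.ncard_coe_finset] at h
    have h' : (Ideal.span (↑t : Set R)).spanFinrank = m.spanFinrank := by rw [ht_span]
    rw [← h']
    exact h

/-! ## Homogeneous generators at a fixed prime -/

section Graded

variable {k : Type u} [Field k] {A : Type w} [DecidableEq A] [AddCommGroup A] {S : Type u}
  [CommRing S] [Algebra k S] (𝒮 : A → Submodule k S) [GradedAlgebra 𝒮]

/-- **A fixed prime is the span of its homogeneous elements**: if `S_a ⊆ 𝔔` for all `a ≠ 0`, every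
homogeneous component of an element of `𝔔` lies in `𝔔` (the degree-`0` component by
`FixedPointFibre.mem_iff_decompose_zero_mem`, the others because they have non-zero degree), so
`𝔔 = span {x ∈ 𝔔 | x homogeneous}`. [folklore; cite: SGA3, Exp. VIII §4–5] -/
theorem span_homogeneous_eq_of_fixed (𝔔 : Ideal S)
    (hfix : ∀ a : A, a ≠ 0 → ∀ s ∈ 𝒮 a, s ∈ 𝔔) :
    Ideal.span {x : S | x ∈ 𝔔 ∧ SetLike.IsHomogeneousElem 𝒮 x} = 𝔔 := by
  classical
  apply le_antisymm
  · exact Ideal.span_le.mpr fun x hx => hx.1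
  · intro s hs
    rw [← sum_support_decompose 𝒮 s]
    refine Ideal.sum_mem _ fun a _ => Ideal.subset_span ⟨?_, a, (decompose 𝒮 s a).2⟩
    by_cases ha : a = 0
    · subst ha
      exact (FixedPointFibre.mem_iff_decompose_zero_mem 𝒮 𝔔 hfix s).mp hs
    · exact hfix a ha _ (decompose 𝒮 s a).2

/-- **Homogeneous minimal generators of the maximal ideal at a fixed point.** For a Noetherian graded
`S` and a prime `𝔔` containing every `S_a`, `a ≠ 0`, there is a finite set `t` of HOMOGENEOUS
elements of `𝔔` whose images generate the maximal ideal of `S_𝔔` and whose cardinality is the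
embedding dimension `spanFinrank (𝔔 S_𝔔) = dim_κ 𝔔S_𝔔/𝔔²S_𝔔` (graded Nakayama: `𝔔` is spanned
by homogeneous elements, `span_homogeneous_eq_of_fixed`, and minimal generators can be extracted
from any generating set, `exists_finset_subset_span_eq_card_eq_spanFinrank`).
[folklore; cite: SGA3, Exp. VIII §4–5; BrunsHerzog1998, Prop. 1.5.15] -/
theorem exists_homogeneous_minimal_generators_of_fixed [IsNoetherianRing S] (𝔔 : Ideal S)
    [𝔔.IsPrime] (hfix : ∀ a : A, a ≠ 0 → ∀ s ∈ 𝒮 a, s ∈ 𝔔) :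
    ∃ t : Finset S, (∀ x ∈ t, x ∈ 𝔔 ∧ SetLike.IsHomogeneousElem 𝒮 x) ∧
      Ideal.span (algebraMap S (Localization.AtPrime 𝔔) '' (↑t : Set S)) =
        maximalIdeal (Localization.AtPrime 𝔔) ∧
      t.card = (maximalIdeal (Localization.AtPrime 𝔔)).spanFinrank := by
  classical
  set H : Set S := {x : S | x ∈ 𝔔 ∧ SetLike.IsHomogeneousElem 𝒮 x} with hH
  set f := algebraMap S (Localization.AtPrime 𝔔) with hf
  have hG : Ideal.span (f '' H) = maximalIdeal (Localization.AtPrime 𝔔) := by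
    rw [← Ideal.map_span, span_homogeneous_eq_of_fixed 𝒮 𝔔 hfix,
      Localization.AtPrime.map_eq_maximalIdeal]
  haveI : IsNoetherianRing (Localization.AtPrime 𝔔) :=
    IsLocalization.isNoetherianRing 𝔔.primeCompl _ inferInstance
  obtain ⟨t', ht'G, ht'span, ht'card⟩ :=
    exists_finset_subset_span_eq_card_eq_spanFinrank (f '' H) hG
  -- pull the generators back to homogeneous elements of `𝔔`
  have hpre : ∀ y : t', ∃ x : S, x ∈ H ∧ f x = y := fun y => by
    obtain ⟨x, hx, hxy⟩ := ht'G y.2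
    exact ⟨x, hx, hxy⟩
  choose g hgH hgf using hpre
  have hg_inj : Function.Injective g := fun y₁ y₂ h => by
    apply Subtype.ext
    rw [← hgf y₁, ← hgf y₂, h]
  let t : Finset S := Finset.univ.image g
  have ht_img : f '' (↑t : Set S) = (↑t' : Set _) := by
    rw [Finset.coe_image, Finset.coe_univ, Set.image_univ, ← Set.range_comp]
    ext y
    constructor
    · rintro ⟨y', rfl⟩
      rw [Function.comp_apply, hgf]
      exact y'.2
    · intro hy
      exact ⟨⟨y, hy⟩, by rw [Function.comp_apply, hgf]⟩
  refine ⟨t, fun x hx => ?_, by rw [ht_img, ht'span], ?_⟩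
  · rw [Finset.mem_image] at hx
    obtain ⟨y, -, rfl⟩ := hx
    exact hgH y
  · rw [Finset.card_image_of_injective _ hg_inj, Finset.card_univ, Fintype.card_coe, ht'card]

/-- **A homogeneous regular system of parameters at a fixed point of a regular graded ring**: for `S`
regular (Mathlib `IsRegularRing`) and a prime `𝔔 ⊇ S_a` (`a ≠ 0`), there are `n = dim S_𝔔`
HOMOGENEOUS elements of `𝔔` whose images generate the maximal ideal of the regular local ring `S_𝔔`.
[folklore; cite: SGA3, Exp. VIII §4–5] -/
theorem exists_homogeneous_regularParameters_of_fixed [IsRegularRing S] (𝔔 : Ideal S)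
    [𝔔.IsPrime] (hfix : ∀ a : A, a ≠ 0 → ∀ s ∈ 𝒮 a, s ∈ 𝔔) :
    ∃ t : Finset S, (∀ x ∈ t, x ∈ 𝔔 ∧ SetLike.IsHomogeneousElem 𝒮 x) ∧
      Ideal.span (algebraMap S (Localization.AtPrime 𝔔) '' (↑t : Set S)) =
        maximalIdeal (Localization.AtPrime 𝔔) ∧
      (t.card : WithBot ℕ∞) = ringKrullDim (Localization.AtPrime 𝔔) := by
  obtain ⟨t, hth, htspan, htcard⟩ := exists_homogeneous_minimal_generators_of_fixed 𝒮 𝔔 hfix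
  haveI : IsRegularLocalRing (Localization.AtPrime 𝔔) :=
    IsRegularRing.isRegularLocalRing_localization 𝔔
  refine ⟨t, hth, htspan, ?_⟩
  rw [htcard]
  exact IsRegularLocalRing.spanFinrank_maximalIdeal

end Graded

end Summit.ResolutionOfSingularities.ResolutionOfSingularities.Theorems.FRationalResolution.FixedPointGenerators

end
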